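import Literature.AlgebraicGeometry.Resolution.AlterationsBlowupDivisor
import Literature.AlgebraicGeometry.Resolution.BlowupGeneratingSections
import HarnessLib

/-!
# Blowing ups of projective schemes are projective (Hartshorne II, Prop. 7.16 (c)) — discharge

Topic: `Literature/AlgebraicGeometry/Resolution`. Sibling proof file of
`AlterationsBlowupDivisor.lean`: DISCHARGES its named fact `BlowupProjectiveOverField`
(Hartshorne II, Prop. 7.16 (c), projective case: the blowing-up `X̃` of a projective variety `X`
over `k` along a nonzero coherent sheaf of ideals is projective over `k`), in the generality of
Görtz–Wedhorn I, Prop. 13.96 (1) with Remark 13.73: for EVERY scheme `X` projective over a field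
`k` (a closed `k`-immersion into some `ℙⁿ_k`), every ideal sheaf `I` and every blowing up
`π : X' → X` of `X` along `I` in the sense of the universal property (`IsBlowup`), `X'` is
projective over `k` (`IsBlowup.isProjectiveOver`) — integrality of `X`, `I ≠ 0` and algebraic
closedness of `k` are not needed.

Proof (Hartshorne II, proof of Prop. 7.10 (b) and of Prop. 7.16 (c), pp. 161, 166, in the chart
form of this library): let `D` be the generating-sections data of the embedding `X ↪ ℙⁿ_k`
(`GeneratingSections.ofHom`: affine charts `U a = X ∩ D₊(x_a)`, ratios `x_b/x_a`). `X` is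
locally Noetherian, so each `I(U a)` has finitely many generators; by the extension lemma
(`GeneratingSections.exists_sec_val_eq`, Görtz–Wedhorn I, Thm. 7.22) refined to sections WITH
VALUES IN `I` (`GeneratingSections.exists_sec_val_eq_mem`: after a further twist by `x_a^N` the
extension lies in `I(U b)` on every chart, `I` being quasi-coherent), they extend to finitely many
global sections of `I ⊗ 𝒪_X(d)` — "a finite number of global sections which generate `𝓢₁ ⊗ 𝓛ⁿ`"
(`blowupSections`). The corresponding sections of `π^*𝒪_X(d+1) ⊗ I·𝒪_{X'}` have affine
non-vanishing loci, the charts `Spec A[I/g]` of the blowing up (`BlowupSections.generatingSections`,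
`BlowupGeneratingSections.lean`; `BlowupPrincipalCharts.lean`), and `X'` is proper over `k`
(`π` is proper, Stacks 02NS), so `X'` is projective over `k` by
`GeneratingSections.isProjectiveOver_of_isAffineOpen` (Görtz–Wedhorn I, Prop. 13.47 with
Cor. 13.72: proper with an ample invertible sheaf is projective).

* `GeneratingSections.exists_pow_mul_mem`, `GeneratingSections.exists_sec_val_eq_mem` —
  extension of sections of `I(U a)` to `I`-valued global sections of `𝓛^{⊗d}` (dot-notation
  extensions of the `Motives/` structure `GeneratingSections`, declared with absolute names);
* `IsBlowup.exists_blowupSections` — the `I`-valued sections data (`BlowupSections`) of a blowing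
  up of a scheme with finitely many affine generating-section charts and finitely generated
  `I(U a)`;
* `IsBlowup.isProjectiveOver` — **blowing ups of projective `k`-schemes are projective**;
* `BlowupProjectiveOverField_holds`, `blowupProjectiveOverField_holds` — the named fact
  DISCHARGED;
* `DeJong1996NormalProjectiveReduction.of_normalization`,
  `DeJong1996InductionStep.of_normalization_of_step`,
  `DeJong1996Strong.of_descent_of_normalization_of_step`,
  `DeJong1996StrongPerfect.of_descent_of_normalization_of_step` — the assemblies of
  `AlterationsBlowupDivisor.lean` with the projectivity of blow-ups fed in (the remaining named
  inputs of de Jong's Thm. 4.1 are `DeJong1996Descent`, `DeJong1996NormalizationReduction`,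
  `DeJong1996NormalProjectiveStep`).

## Sources

* R. Hartshorne, *Algebraic Geometry*, GTM 52 (1977), II Prop. 7.10 (b) (p. 161), Prop. 7.16 (c)
  (p. 166), Lemma 5.14 / Thm. 7.6 (extension of sections). [Hartshorne1977]
* U. Görtz, T. Wedhorn, *Algebraic Geometry I*, 2nd ed. (2020), Thm. 7.22, Prop. 13.47,
  Cor. 13.72, Remark 13.73, Prop. 13.96 (1). [GortzWedhorn2020]
* The Stacks Project, Tags 0804, 02NS. [StacksProject]
-/

noncomputable section

open CategoryTheory CategoryTheory.Limits AlgebraicGeometry TopologicalSpace Opposite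
open Literature.AlgebraicGeometry.Motives Literature.AlgebraicGeometry.Motives.GeneratingSections

universe u

namespace Literature.AlgebraicGeometry.Resolution

/-! ## Extension of sections with values in an ideal sheaf -/

section Extend

variable {ι : Type} {Y : Scheme.{u}} (D : GeneratingSections ι Y) (hU : ∀ i, IsAffineOpen (D.U i))
  (I : Y.IdealSheafData)

include hU in
/-- A section of `U j` whose restriction to `U j ∩ U i = (U j)_{s_i/s_j}` lies in the ideal sheaf
`I` lies in `I(U j)` after multiplication by a power of `s_i/s_j` (quasi-coherence of `I`:
`I((U j)_r) = I(U j)[1/r]`). Deliberate dot-notation extension of the structure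
`Literature.AlgebraicGeometry.Motives.GeneratingSections` (`Motives/MorphismsToProjectiveSpace`).
[folklore] -/
theorem _root_.Literature.AlgebraicGeometry.Motives.GeneratingSections.exists_pow_mul_mem
    (i j : ι) (c : Γ(Y, D.U j))
    (hc : rs (D.V_le_left j i) c ∈ I.ideal (Y.affineBasicOpen (U := ⟨D.U j, hU j⟩) (D.ratio j i))) :
    ∃ n : ℕ, c * D.ratio j i ^ n ∈ I.ideal ⟨D.U j, hU j⟩ := by
  set r : Γ(Y, D.U j) := D.ratio j i with hr
  haveI := (hU j).isLocalization_basicOpen r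
  rw [← I.map_ideal_basicOpen ⟨D.U j, hU j⟩ r] at hc
  change algebraMap Γ(Y, D.U j) Γ(Y, Y.basicOpen r) c ∈
    (I.ideal ⟨D.U j, hU j⟩).map (algebraMap Γ(Y, D.U j) Γ(Y, Y.basicOpen r)) at hc
  obtain ⟨⟨⟨a, ha⟩, ⟨_, k, rfl⟩⟩, e⟩ :=
    (IsLocalization.mem_map_algebraMap_iff (Submonoid.powers r) Γ(Y, Y.basicOpen r)).mp hc
  change algebraMap _ _ c * algebraMap _ _ (r ^ k) = algebraMap _ _ a at e
  rw [← map_mul] at e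
  obtain ⟨⟨_, k', rfl⟩, e'⟩ := (IsLocalization.eq_iff_exists (Submonoid.powers r) _).mp e
  change r ^ k' * (c * r ^ k) = r ^ k' * a at e'
  refine ⟨k' + k, ?_⟩
  have : c * r ^ (k' + k) = r ^ k' * a := by rw [← e']; ring
  rw [this]
  exact Ideal.mul_mem_left _ _ ha

include hU in
/-- **Extension of sections with values in an ideal sheaf** (Hartshorne II Lemma 5.14 (b) /
Görtz–Wedhorn I Thm. 7.22 for `I ⊗ 𝓛^{⊗d}`): if `ι` is finite and the `U i` are affine, every
`b ∈ I(U i)` is the `U i`-value of a global section `t` of some `𝓛^{⊗d}` ALL of whose chart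
values lie in `I` — extend `b` (`exists_sec_val_eq`), then twist by a further `s_i^{⊗N}` to push
every chart value into `I(U j)` (`exists_pow_mul_mem`). Deliberate dot-notation extension of the
structure `Literature.AlgebraicGeometry.Motives.GeneratingSections`. [cite: GortzWedhorn2020, Thm. 7.22] -/
theorem _root_.Literature.AlgebraicGeometry.Motives.GeneratingSections.exists_sec_val_eq_mem
    [Finite ι] (i : ι) (b : Γ(Y, D.U i))
    (hb : b ∈ I.ideal ⟨D.U i, hU i⟩) :
    ∃ (d : ℕ) (t : D.Sec d), t.val i = b ∧ ∀ j, t.val j ∈ I.ideal ⟨D.U j, hU j⟩ := by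
  obtain ⟨d, t, ht⟩ := D.exists_sec_val_eq hU i b
  -- on `U j ∩ U i` the value `t_j` is `b` times a unit, hence lies in `I`
  have H : ∀ j, ∃ n : ℕ, t.val j * D.ratio j i ^ n ∈ I.ideal ⟨D.U j, hU j⟩ := by
    intro j
    refine D.exists_pow_mul_mem hU I i j (t.val j) ?_
    have hV : (Y.affineBasicOpen (U := ⟨D.U j, hU j⟩) (D.ratio j i) : Y.Opens) ≤ D.U i :=
      D.V_le_right j i
    have hbV : rs (D.V_le_right j i) b ∈
        I.ideal (Y.affineBasicOpen (U := ⟨D.U j, hU j⟩) (D.ratio j i)) := by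
      rw [← I.map_ideal (U := Y.affineBasicOpen (U := ⟨D.U j, hU j⟩) (D.ratio j i))
        (V := ⟨D.U i, hU i⟩) hV]
      exact Ideal.mem_map_of_mem _ hb
    rw [t.compat' i j, ht]
    exact Ideal.mul_mem_right _ _ hbV
  choose n hn using H
  obtain ⟨N, hN⟩ : ∃ N, ∀ j, n j ≤ N := by
    haveI := Fintype.ofFinite ι
    exact ⟨Finset.univ.sup n, fun j ↦ Finset.le_sup (Finset.mem_univ j)⟩
  refine ⟨d + N, t.mul (Sec.pow D i N), ?_, fun j => ?_⟩
  · rw [Sec.mul_val, Sec.pow_val, ht, D.ratio_self, one_pow, mul_one]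
  · rw [Sec.mul_val, Sec.pow_val, ← Nat.add_sub_cancel' (hN j), pow_add, ← mul_assoc]
    exact Ideal.mul_mem_right _ _ (hn j)

end Extend

/-! ## Blowing ups of projective schemes are projective -/

variable {ι : Type} {X' X : Scheme.{u}} {I : X.IdealSheafData} {π : X' ⟶ X}

/-- **The `I`-valued sections data of a blowing up** of a scheme `X` carrying generating-sections
data `D` with finitely many affine charts on which `I` is finitely generated: finitely many
generators of each `I(U a)` extend to `I`-valued global sections of a common `𝓛^{⊗d}`
(`GeneratingSections.exists_sec_val_eq_mem`) — "a finite number of global sections which generate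
`𝓢₁ ⊗ 𝓛ⁿ`", Hartshorne II, proof of Prop. 7.10 (b). [cite: Hartshorne1977, II Prop. 7.10 (b) (proof)] -/
theorem IsBlowup.exists_blowupSections [Finite ι] (D : GeneratingSections ι X)
    (hU : ∀ a, IsAffineOpen (D.U a)) (hfg : ∀ a, (I.ideal ⟨D.U a, hU a⟩).FG) (hπ : IsBlowup π I) :
    ∃ (n : ι → ℕ), Nonempty (BlowupSections D I π (Σ a, Fin (n a))) := by
  classical
  -- generators
  have hgen : ∀ a, ∃ (n : ℕ) (x : Fin n → Γ(X, D.U a)),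
      Ideal.span (Set.range x) = I.ideal ⟨D.U a, hU a⟩ := fun a =>
    Submodule.fg_iff_exists_fin_generating_family.mp (hfg a)
  choose n x hx using hgen
  have hxmem : ∀ a l, x a l ∈ I.ideal ⟨D.U a, hU a⟩ := fun a l =>
    hx a ▸ Ideal.subset_span (Set.mem_range_self l)
  -- extensions
  choose d t ht htmem using fun a l => D.exists_sec_val_eq_mem hU I a (x a l) (hxmem a l)
  -- uniform degree
  obtain ⟨N, hN⟩ : ∃ N, ∀ a l, d a l ≤ N := by
    haveI := Fintype.ofFinite ι
    refine ⟨Finset.univ.sup fun p : Σ a, Fin (n a) => d p.1 p.2, fun a l => ?_⟩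
    exact Finset.le_sup (f := fun p : Σ a, Fin (n a) => d p.1 p.2) (Finset.mem_univ ⟨a, l⟩)
  let sec : (Σ a, Fin (n a)) → D.Sec N := fun p =>
    ((t p.1 p.2).mul (GeneratingSections.Sec.pow D p.1 (N - d p.1 p.2))).cast
      (Nat.add_sub_cancel' (hN p.1 p.2))
  have hsec : ∀ (p : Σ a, Fin (n a)) (c : ι),
      (sec p).val c = (t p.1 p.2).val c * D.ratio c p.1 ^ (N - d p.1 p.2) := fun p c => rfl
  refine ⟨n, ⟨⟨hU, hπ, Sigma.fst, N, sec, fun p c => ?_, fun a => ?_⟩⟩⟩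
  · rw [hsec]
    exact Ideal.mul_mem_right _ _ (htmem p.1 p.2 c)
  · rw [← hx a]
    congr 1
    apply Set.Subset.antisymm
    · rintro _ ⟨⟨⟨a', l⟩, rfl : a' = a⟩, rfl⟩
      refine ⟨l, ?_⟩
      change x a' l = (sec ⟨a', l⟩).val a'
      rw [hsec, ht, D.ratio_self, one_pow, mul_one]
    · rintro _ ⟨l, rfl⟩
      refine ⟨⟨⟨a, l⟩, rfl⟩, ?_⟩
      change (sec ⟨a, l⟩).val a = x a l
      rw [hsec, ht, D.ratio_self, one_pow, mul_one]

/-- **Blowing ups of projective schemes over a field are projective** (Hartshorne II,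
Prop. 7.16 (c), projective case, without the integrality and `𝓘 ≠ 0` hypotheses; Görtz–Wedhorn I,
Prop. 13.96 (1) with Remark 13.73 and Summary 13.71 (3)): if `X` is projective over the field `k`
and `π : X' → X` is a blowing up of `X` along any ideal sheaf `I` (universal property,
`IsBlowup`), then `X'` is projective over `k`. Proof as in Hartshorne II, 7.10 (b): the sections
`π^*(x_a ⊗ G)` of `π^*𝒪_X(d+1) ⊗ I·𝒪_{X'}`, `G` running over `I`-valued extensions of generators of
the `I(X ∩ D₊(x_a))`, generate, with affine non-vanishing loci `Spec A[I/g]`; `X'` is proper over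
`k`; conclude by `GeneratingSections.isProjectiveOver_of_isAffineOpen`.
[cite: Hartshorne1977, II Prop. 7.16 (c), p. 166] -/
theorem IsBlowup.isProjectiveOver {k : Type u} [Field k] (f : X ⟶ Spec (.of k))
    (hproj : IsProjectiveOver (Over.mk f)) (hπ : IsBlowup π I) :
    IsProjectiveOver (Over.mk (π ≫ f)) := by
  obtain ⟨n, emb, hemb⟩ := hproj
  haveI := hemb
  have inst : IsAffineHom emb.left := inferInstance
  haveI : IsProper f := IsProjectiveOver.isProper (X := Over.mk f) ⟨n, emb, hemb⟩
  haveI : IsLocallyNoetherian X := LocallyOfFiniteType.isLocallyNoetherian f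
  haveI : IsProper π := hπ.isProper
  -- the generating sections of the embedding: affine charts `X ∩ D₊(x_a)`
  let D : GeneratingSections (Fin (n + 1)) X :=
    GeneratingSections.ofHom (k := k) (ι := Fin (n + 1)) emb.left
  have hU : ∀ a, IsAffineOpen (D.U a) := fun a =>
    @GeneratingSections.isAffineOpen_ofHom_U (Fin (n + 1)) k _ _ emb.left inst a
  have hfg : ∀ a, (I.ideal ⟨D.U a, hU a⟩).FG := fun a =>
    haveI := IsLocallyNoetherian.component_noetherian (⟨D.U a, hU a⟩ : X.affineOpens)
    IsNoetherian.noetherian _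
  obtain ⟨nn, ⟨S⟩⟩ := hπ.exists_blowupSections D hU hfg
  haveI : IsProper (Over.mk (π ≫ f) : SchemeOver k).hom := by
    change IsProper (π ≫ f)
    infer_instance
  exact GeneratingSections.isProjectiveOver_of_isAffineOpen (Z := Over.mk (π ≫ f))
    S.generatingSections S.isAffineOpen_generatingSections_U

/-- DISCHARGE of the named fact `BlowupProjectiveOverField` (`AlterationsBlowupDivisor.lean`):
**Hartshorne II, Prop. 7.16 (c), projective case** — the blowing-up of a projective variety over
an algebraically closed field along a nonzero coherent sheaf of ideals is projective — by
`IsBlowup.isProjectiveOver` (which needs neither integrality, nor `𝓘 ≠ 0`, nor `k = k̄`).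
[cite: Hartshorne1977, II Prop. 7.16 (c), p. 166] -/
theorem BlowupProjectiveOverField_holds : BlowupProjectiveOverField.{u} :=
  fun _ _ _ _ _ f _ _ _ hproj _ hπ => hπ.isProjectiveOver f hproj

/-- The same discharge under the lower-camel-case name. [cite: Hartshorne1977, II Prop. 7.16 (c), p. 166] -/
theorem blowupProjectiveOverField_holds : BlowupProjectiveOverField.{u} :=
  BlowupProjectiveOverField_holds

/-! ## Unconditional forms of the reductions of `AlterationsBlowupDivisor.lean` -/

/-- **de Jong 1996, 4.6–4.10 from the normalisation step alone**: with the projectivity of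
blow-ups proved, the reduction to normal projective pairs `DeJong1996NormalProjectiveReduction`
follows from `DeJong1996NormalizationReduction` (4.10). [cite: DeJong1996, 4.6–4.10, pp. 66–67] -/
theorem DeJong1996NormalProjectiveReduction.of_normalization
    (hN : DeJong1996NormalizationReduction.{u}) : DeJong1996NormalProjectiveReduction.{u} :=
  DeJong1996NormalProjectiveReduction.of_blowupProjective_of_normalization
    BlowupProjectiveOverField_holds hN

/-- The induction step of de Jong's Thm. 4.1 from the normalisation step 4.10 and the step
4.11–4.28 for normal projective pairs. [cite: DeJong1996, 4.6–4.28, pp. 66–76] -/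
theorem DeJong1996InductionStep.of_normalization_of_step (hN : DeJong1996NormalizationReduction.{u})
    (hstep : DeJong1996NormalProjectiveStep.{u}) : DeJong1996InductionStep.{u} :=
  DeJong1996InductionStep.of_blowupProjective_of_normalization_of_step
    BlowupProjectiveOverField_holds hN hstep

/-- **Assembly of de Jong's Thm. 4.1 (i)+(ii)** from 4.5 (`DeJong1996Descent`), 4.10
(`DeJong1996NormalizationReduction`) and 4.11–4.28 (`DeJong1996NormalProjectiveStep`); the
projectivity of blow-ups (Hartshorne II 7.16 (c)) is now proved. [cite: DeJong1996, 4.3–4.28, pp. 66–76] -/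
theorem DeJong1996Strong.of_descent_of_normalization_of_step (h45 : DeJong1996Descent.{u})
    (hN : DeJong1996NormalizationReduction.{u}) (hstep : DeJong1996NormalProjectiveStep.{u}) :
    DeJong1996Strong.{u} :=
  DeJong1996Strong.of_descent_of_blowupProjective_of_normalization_of_step h45
    BlowupProjectiveOverField_holds hN hstep

/-- The same assembly for the last sentence of de Jong's Thm. 4.1 (perfect ground fields).
[cite: DeJong1996, 4.3–4.28, pp. 66–76] -/
theorem DeJong1996StrongPerfect.of_descent_of_normalization_of_step (h45 : DeJong1996Descent.{u})
    (hN : DeJong1996NormalizationReduction.{u}) (hstep : DeJong1996NormalProjectiveStep.{u}) :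
    DeJong1996StrongPerfect.{u} :=
  DeJong1996StrongPerfect.of_descent_of_blowupProjective_of_normalization_of_step h45
    BlowupProjectiveOverField_holds hN hstep

end Literature.AlgebraicGeometry.Resolution

end
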